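import Summits.BirchSwinnertonDyer.BirchSwinnertonDyer.Theorems.BiquadraticEisensteinDescentHeegnerTwistCouplingInSupplySymbolicMonskyTransport
import HarnessLib

set_option linter.dupNamespace false -- `Summit.BirchSwinnertonDyer.BirchSwinnertonDyer.Theorems.…` (summit = sub)
set_option autoImplicit false

/-!
# Crux `HeegnerTwistCouplingInSupply` (stmt-BirchSwinnertonDyer-21381), card `sign-table-character-dichotomy`:
# REALISED RECIPES of the sign-table game have `det M = 1` for the ACTUAL primes and the Heegner splitting conditions

Cell `pub/bsd-wall`, width-prover seat `bsd-wall-cm-bed-w3` g18; fourth file of the symbolic Monsky engine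
(`…SymbolicMonskyDefs.lean` definitions, `…SymbolicMonskySound.lean` soundness, `…SymbolicMonskyTransport.lean` transport).
For a recipe `rcp` (cells, assumed signs `(q_i/p)`, chosen mutual symbols) REALISED by actual primes — `rcp.RealisesK1 pc rc rp p r q`
on the two-parameter bases `E_{pr}`, `E_{2pr}` (resp. `rcp.RealisesK0 pc p q` on `E_p`, `E_{2p}`): the primes realise the
recipe's symbol data (`toMatches`), so a WINNING recipe (`winsPR` / `wins2PR` / `winsP` / `wins2P` — the kernel-decidable
predicates decided over the covers in `…SignTableCompletion.lean`) gives **`det (monskyMatrixOdd/Even (p, r, q₁, …, q_t)) = 1`**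
for the tree's Monsky matrices [HeathBrown1994, appendix (Monsky)] of the ACTUAL number `n₀·q₁⋯q_t`, and its Heegner check gives
**`q₁⋯q_t ≡ 7 (mod 8)`, `(−q₁⋯q_t / p) = +1`, `(−q₁⋯q_t / r) = +1`** — i.e. `2`, `p`, `r` split in `K′ = ℚ(√−q₁⋯q_t)`, the
Heegner hypothesis for the levels `32 (p r)²` / `2⁶ (p r)²` of `E_{pr}` / `E_{2pr}` (and `32 p²` / `2⁶ p²`).
What this does NOT give: the EXISTENCE of small primes realising a winning recipe for the actual table `q ↦ (q/p)` — the card's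
analytic input (Burgess / bilinear sieve / Linnik, untyped) — nor anything for CM curves with `E[2]` irreducible; the crux as stated
(C⁺) and BSD are untouched. THEOREMS ONLY. Supports stmt-BirchSwinnertonDyer-21381.
-/

namespace Summit.BirchSwinnertonDyer.BirchSwinnertonDyer.Theorems.SymbolicMonsky

open Matrix Literature.NumberTheory.EllipticCurves Literature.NumberTheory.EllipticCurves.HeathBrown1994
  Literature.NumberTheory.EllipticCurves.HeathBrown1994.Families

/-! ## Realised recipes: the Monsky matrix of the actual primes, and the Heegner conditions -/


section Realise

/-- `sgn` is multiplicative for XOR. (Private: a textually identical statement about an unrelated `sgn` exists in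
`Literature/Computability`.) -/
private theorem sgn_xor (a b : Bool) : sgn (xor a b) = sgn a * sgn b := by
  cases a <;> cases b <;> decide

/-- Product of signs along a list = sign of the XOR. -/
theorem prod_map_sgn (L : List Bool) : (L.map sgn).prod = sgn (xorFold L id) := by
  induction L with
  | nil => rfl
  | cons a L ih => rw [List.map_cons, List.prod_cons, ih, xorFold_cons, sgn_xor]; rfl

/-- A `±1`-valued symbol characterised by `= −1 ↔ c` equals `sgn c`. -/
theorem jacobiSym_eq_sgn_of_iff {a : ℤ} {b : ℕ} {c : Bool} (hval : jacobiSym a b = 1 ∨ jacobiSym a b = -1)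
    (hiff : jacobiSym a b = -1 ↔ c = true) : jacobiSym a b = sgn c := by
  rcases hval with h | h
  · rw [h]
    cases hc : c
    · rfl
    · exact absurd (hiff.mpr hc) (by rw [h]; decide)
  · rw [h, hiff.mp h]; rfl

/-- `J(∏ aᵢ | b) = ∏ J(aᵢ | b)`. [folklore] -/
theorem jacobiSym_finset_prod_left {ι : Type*} (s : Finset ι) (f : ι → ℕ) (b : ℕ) :
    jacobiSym ((∏ i ∈ s, f i : ℕ) : ℤ) b = ∏ i ∈ s, jacobiSym (f i : ℤ) b := by
  classical
  induction s using Finset.induction_on with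
  | empty => simp [jacobiSym.one_left]
  | insert a s ha ih => rw [Finset.prod_insert ha, Finset.prod_insert ha, Nat.cast_mul, jacobiSym.mul_left, ih]

variable {rcp : Recipe}

/-- The cell list is the list of `cell i`, `i < t`. -/
theorem Recipe.cells_eq_map : rcp.cells = (List.finRange rcp.t).map (fun i : Fin rcp.t => rcp.cell i.val) := by
  apply List.ext_getElem
  · simp [Recipe.t]
  · intro n h1 h2
    simp [Recipe.cell, List.getD_eq_getElem?_getD, h1]

/-- The sign list is the list of `sign i`, `i < t` (when it has the right length). -/
theorem Recipe.signs_eq_map (ht : rcp.signs.length = rcp.t) :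
    rcp.signs = (List.finRange rcp.t).map (fun i : Fin rcp.t => rcp.sign i.val) := by
  apply List.ext_getElem
  · simp [ht]
  · intro n h1 h2
    simp [Recipe.sign, List.getD_eq_getElem?_getD, h1]

/-- `∏ᵢ f (cell i)` over `Fin t` is the list product over the cells. -/
theorem Recipe.prod_cell_eq (f : Fin 4 × Bool → ℕ) : ∏ i : Fin rcp.t, f (rcp.cell i) = (rcp.cells.map f).prod := by
  rw [← List.prod_ofFn, List.ofFn_eq_map]
  conv_rhs => rw [rcp.cells_eq_map, List.map_map]
  rfl

/-- XOR over `Fin t` of a function of the cells = XOR over the cell list. -/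
theorem Recipe.xorFold_cell_eq (f : Fin 4 × Bool → Bool) :
    xorFold (List.finRange rcp.t) (fun i : Fin rcp.t => f (rcp.cell i.val)) = xorFold rcp.cells f := by
  conv_rhs => rw [rcp.cells_eq_map, xorFold_map]
  rfl

/-- XOR over `Fin t` of the signs = XOR over the sign list. -/
theorem Recipe.xorFold_sign_eq (ht : rcp.signs.length = rcp.t) :
    xorFold (List.finRange rcp.t) (fun i : Fin rcp.t => rcp.sign i.val) = xorFold rcp.signs id := by
  conv_rhs => rw [rcp.signs_eq_map ht, xorFold_map]
  rfl

/-- Product over `Fin n` of signs = sign of the XOR-fold. -/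
theorem prod_sgn_eq_sgn_xorFold {n : ℕ} (g : Fin n → Bool) : ∏ i, sgn (g i) = sgn (xorFold (List.finRange n) g) := by
  rw [← List.prod_ofFn, List.ofFn_eq_map]
  have : (List.finRange n).map (fun i => sgn (g i)) = ((List.finRange n).map g).map sgn := by rw [List.map_map]; rfl
  rw [this, prod_map_sgn, xorFold_map]
  rfl

/-- Unpacking of the Heegner check. -/
theorem Recipe.heegner_spec {pc : Fin 4} {orc : Option (Fin 4)} (h : rcp.heegner pc orc = true) :
    0 < rcp.t ∧ rcp.signs.length = rcp.t ∧ (rcp.cells.map fun c => clsVal c.1).prod % 8 = 7 ∧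
      xorFold rcp.signs id = negNegOne pc ∧ (∀ rc, orc = some rc → xorFold rcp.cells (fun c => c.2) = negNegOne rc) := by
  simp only [Recipe.heegner, Bool.and_eq_true, decide_eq_true_eq, beq_iff_eq] at h
  obtain ⟨⟨⟨⟨ht, hlen⟩, hprod⟩, hsg⟩, hr⟩ := h
  refine ⟨ht, hlen, hprod, hsg, fun rc hrc => ?_⟩
  subst hrc
  simpa using hr

namespace Recipe.RealisesK1

variable {pc rc : Fin 4} {rp : Bool} {p r' : ℕ} {q : Fin rcp.t → ℕ}

/-- A realised two-parameter recipe realises its symbol data. -/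
theorem toMatches (h : rcp.RealisesK1 pc rc rp p r' q) :
    Matches (Fin.cons p (Fin.cons r' q) : Fin (rcp.t + 2) → ℕ) (rcp.dataK1 pc rc rp) where
  prime i := by
    refine Fin.cases ?_ (fun i => ?_) i
    · simpa using h.pprime
    · refine Fin.cases ?_ (fun i => ?_) i
      · simpa using h.rprime
      · simpa using h.qprime i
  injective := by
    rw [Fin.cons_injective_iff, Fin.cons_injective_iff]
    refine ⟨?_, ?_, h.qinj⟩
    · rintro ⟨j, hj⟩
      revert hj
      refine Fin.cases ?_ (fun j => ?_) j
      · simpa using fun hh => h.p_ne_r hh.symm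
      · simpa using h.q_ne_p j
    · rintro ⟨j, hj⟩
      exact h.q_ne_r j hj
  mod_eight i := by
    refine Fin.cases ?_ (fun i => ?_) i
    · simpa [Recipe.dataK1] using h.p_mod
    · refine Fin.cases ?_ (fun i => ?_) i
      · simpa [Recipe.dataK1] using h.r_mod
      · simpa [Recipe.dataK1] using h.q_mod i
  up_iff i j hij := by
    revert hij
    refine Fin.cases ?_ (fun i => ?_) i <;> refine Fin.cases ?_ (fun j => ?_) j
    · intro hij; exact absurd hij (lt_irrefl _)
    · refine Fin.cases ?_ (fun j => ?_) j
      · intro; simpa [Recipe.dataK1] using h.rp_iff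
      · intro; simpa [Recipe.dataK1] using h.sign_iff j
    · intro hij; exact absurd hij (Fin.not_lt_zero _)
    · revert i
      refine Fin.cases ?_ (fun i => ?_)
      · refine Fin.cases ?_ (fun j => ?_) j
        · intro hij; exact absurd hij (lt_irrefl _)
        · intro; simpa [Recipe.dataK1] using h.eps_iff j
      · refine Fin.cases ?_ (fun j => ?_) j
        · intro hij
          exact absurd hij (by simp [Fin.lt_def])
        · intro hij
          have hij' : i < j := Fin.succ_lt_succ_iff.mp (Fin.succ_lt_succ_iff.mp hij)
          have e1 : (i.succ.succ).val = i.val + 2 := by simp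
          have e2 : (j.succ.succ).val = j.val + 2 := by simp
          have key := h.qsym_iff i j hij'
          simp only [Recipe.dataK1, Fin.cons_succ, e1, e2, Nat.add_sub_cancel, Nat.add_eq_zero_iff, and_false,
            if_false, OfNat.ofNat_ne_zero, Nat.add_eq_one_iff]
          simpa using key

/-- **`det = 1` for the actual primes** of a realised winning recipe (odd base `E_{pr}`). -/
theorem det_odd (h : rcp.RealisesK1 pc rc rp p r' q) (hw : rcp.winsPR pc rc rp = true) :
    (monskyMatrixOdd (Fin.cons p (Fin.cons r' q) : Fin (rcp.t + 2) → ℕ)).det = 1 := by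
  simp only [Recipe.winsPR, Bool.and_eq_true] at hw
  exact h.toMatches.det_monskyMatrixOdd_eq_one hw.2

/-- **`det = 1` for the actual primes** of a realised winning recipe (even base `E_{2pr}`). -/
theorem det_even (h : rcp.RealisesK1 pc rc rp p r' q) (hw : rcp.wins2PR pc rc rp = true) :
    (monskyMatrixEven (Fin.cons p (Fin.cons r' q) : Fin (rcp.t + 2) → ℕ)).det = 1 := by
  simp only [Recipe.wins2PR, Bool.and_eq_true] at hw
  exact h.toMatches.det_monskyMatrixEven_eq_one hw.2

/-- The auxiliary product is `≡ 7 (mod 8)`. -/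
theorem prod_mod_eight (h : rcp.RealisesK1 pc rc rp p r' q) (hw : rcp.heegner pc (some rc) = true) :
    (∏ i, q i) % 8 = 7 := by
  obtain ⟨-, -, hprod, -, -⟩ := rcp.heegner_spec hw
  rw [Finset.prod_nat_mod, Finset.prod_congr rfl (fun i _ => h.q_mod i), Recipe.prod_cell_eq (fun c => clsVal c.1)]
  exact hprod

/-- `(−1/p)` from the class of `p`. -/
theorem jacobiSym_neg_one_eq_sgn {m : ℕ} {c : Fin 4} (hm : m % 8 = clsVal c) : jacobiSym (-1) m = sgn (negNegOne c) := by
  have hmem := clsVal_mem c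
  rw [negNegOne_eq]
  by_cases hc : clsVal c = 3 ∨ clsVal c = 7
  · rw [decide_eq_true hc, DeuringLadic.jacobiSym_neg_one_of_mod_four (by omega)]; rfl
  · rw [decide_eq_false hc, jacobiSym_neg_one_eq_one (by omega)]; rfl

/-- `(−q₁⋯q_t / p) = +1`: `p` splits in `ℚ(√−q₁⋯q_t)`. -/
theorem jacobiSym_neg_prod_p (h : rcp.RealisesK1 pc rc rp p r' q) (hw : rcp.heegner pc (some rc) = true) :
    jacobiSym (-((∏ i, q i : ℕ) : ℤ)) p = 1 := by
  obtain ⟨-, hlen, -, hsg, -⟩ := rcp.heegner_spec hw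
  have hq : ∀ i, jacobiSym (q i : ℤ) p = sgn (rcp.sign i) := fun i =>
    jacobiSym_eq_sgn_of_iff
      (jacobiSym.eq_one_or_neg_one (int_gcd_eq_one_of_primes (h.qprime i) h.pprime (h.q_ne_p i))) (h.sign_iff i)
  rw [neg_eq_neg_one_mul, jacobiSym.mul_left, jacobiSym_neg_one_eq_sgn h.p_mod, jacobiSym_finset_prod_left,
    Finset.prod_congr rfl (fun i _ => hq i), prod_sgn_eq_sgn_xorFold, rcp.xorFold_sign_eq hlen, ← sgn_xor, hsg,
    Bool.xor_self]
  rfl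

/-- `(−q₁⋯q_t / r) = +1`: `r` splits in `ℚ(√−q₁⋯q_t)`. -/
theorem jacobiSym_neg_prod_r (h : rcp.RealisesK1 pc rc rp p r' q) (hw : rcp.heegner pc (some rc) = true) :
    jacobiSym (-((∏ i, q i : ℕ) : ℤ)) r' = 1 := by
  obtain ⟨-, -, -, -, hr⟩ := rcp.heegner_spec hw
  have hr := hr rc rfl
  have hq : ∀ i, jacobiSym (q i : ℤ) r' = sgn (rcp.cell i).2 := fun i =>
    jacobiSym_eq_sgn_of_iff
      (jacobiSym.eq_one_or_neg_one (int_gcd_eq_one_of_primes (h.qprime i) h.rprime (h.q_ne_r i))) (h.eps_iff i)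
  rw [neg_eq_neg_one_mul, jacobiSym.mul_left, jacobiSym_neg_one_eq_sgn h.r_mod, jacobiSym_finset_prod_left,
    Finset.prod_congr rfl (fun i _ => hq i), prod_sgn_eq_sgn_xorFold (fun i : Fin rcp.t => (rcp.cell i.val).2),
    rcp.xorFold_cell_eq (fun c => c.2), ← sgn_xor, hr, Bool.xor_self]
  rfl

end Recipe.RealisesK1

namespace Recipe.RealisesK0

variable {pc : Fin 4} {p : ℕ} {q : Fin rcp.t → ℕ}

/-- A realised one-parameter recipe realises its symbol data. -/
theorem toMatches (h : rcp.RealisesK0 pc p q) :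
    Matches (Fin.cons p q : Fin (rcp.t + 1) → ℕ) (rcp.dataK0 pc) where
  prime i := by
    refine Fin.cases ?_ (fun i => ?_) i
    · simpa using h.pprime
    · simpa using h.qprime i
  injective := by
    rw [Fin.cons_injective_iff]
    refine ⟨?_, h.qinj⟩
    rintro ⟨j, hj⟩
    exact h.q_ne_p j hj
  mod_eight i := by
    refine Fin.cases ?_ (fun i => ?_) i
    · simpa [Recipe.dataK0] using h.p_mod
    · simpa [Recipe.dataK0] using h.q_mod i
  up_iff i j hij := by
    revert hij
    refine Fin.cases ?_ (fun i => ?_) i <;> refine Fin.cases ?_ (fun j => ?_) j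
    · intro hij; exact absurd hij (lt_irrefl _)
    · intro; simpa [Recipe.dataK0] using h.sign_iff j
    · intro hij; exact absurd hij (Fin.not_lt_zero _)
    · intro hij
      have hij' : i < j := Fin.succ_lt_succ_iff.mp hij
      have e1 : (i.succ).val = i.val + 1 := by simp
      have e2 : (j.succ).val = j.val + 1 := by simp
      have key := h.qsym_iff i j hij'
      simp only [Recipe.dataK0, Fin.cons_succ, e1, e2, Nat.add_sub_cancel, Nat.add_eq_zero_iff, and_false,
        if_false, one_ne_zero]
      simpa using key

/-- **`det = 1` for the actual primes** of a realised winning recipe (odd base `E_p`). -/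
theorem det_odd (h : rcp.RealisesK0 pc p q) (hw : rcp.winsP pc = true) :
    (monskyMatrixOdd (Fin.cons p q : Fin (rcp.t + 1) → ℕ)).det = 1 := by
  simp only [Recipe.winsP, Bool.and_eq_true] at hw
  exact h.toMatches.det_monskyMatrixOdd_eq_one hw.2

/-- **`det = 1` for the actual primes** of a realised winning recipe (even base `E_{2p}`). -/
theorem det_even (h : rcp.RealisesK0 pc p q) (hw : rcp.wins2P pc = true) :
    (monskyMatrixEven (Fin.cons p q : Fin (rcp.t + 1) → ℕ)).det = 1 := by
  simp only [Recipe.wins2P, Bool.and_eq_true] at hw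
  exact h.toMatches.det_monskyMatrixEven_eq_one hw.2

/-- The auxiliary product is `≡ 7 (mod 8)`. -/
theorem prod_mod_eight (h : rcp.RealisesK0 pc p q) (hw : rcp.heegner pc none = true) :
    (∏ i, q i) % 8 = 7 := by
  obtain ⟨-, -, hprod, -, -⟩ := rcp.heegner_spec hw
  rw [Finset.prod_nat_mod, Finset.prod_congr rfl (fun i _ => h.q_mod i), Recipe.prod_cell_eq (fun c => clsVal c.1)]
  exact hprod

/-- `(−q₁⋯q_t / p) = +1`: `p` splits in `ℚ(√−q₁⋯q_t)`. -/
theorem jacobiSym_neg_prod_p (h : rcp.RealisesK0 pc p q) (hw : rcp.heegner pc none = true) :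
    jacobiSym (-((∏ i, q i : ℕ) : ℤ)) p = 1 := by
  obtain ⟨-, hlen, -, hsg, -⟩ := rcp.heegner_spec hw
  have hq : ∀ i, jacobiSym (q i : ℤ) p = sgn (rcp.sign i) := fun i =>
    jacobiSym_eq_sgn_of_iff
      (jacobiSym.eq_one_or_neg_one (int_gcd_eq_one_of_primes (h.qprime i) h.pprime (h.q_ne_p i))) (h.sign_iff i)
  rw [neg_eq_neg_one_mul, jacobiSym.mul_left, RealisesK1.jacobiSym_neg_one_eq_sgn h.p_mod, jacobiSym_finset_prod_left,
    Finset.prod_congr rfl (fun i _ => hq i), prod_sgn_eq_sgn_xorFold, rcp.xorFold_sign_eq hlen, ← sgn_xor, hsg,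
    Bool.xor_self]
  rfl

end Recipe.RealisesK0

end Realise

end Summit.BirchSwinnertonDyer.BirchSwinnertonDyer.Theorems.SymbolicMonsky
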